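import Literature.AlgebraicGeometry.Frobenioids.PadicFrobenioidRelTop
import Literature.AlgebraicGeometry.Frobenioids.PadicFrobenioidBaseGaloisSystemPushIso
import Literature.AlgebraicGeometry.Frobenioids.PadicKummerThm24iFrobenioidRelBase
import HarnessLib

/-!
# `Ψ_Base = φ_*` naturally on the ABSOLUTE small base `𝓑^temp(Π)⁰`, for the `φ` READ OFF a straightening
# ([FrdII] Thm. 2.4, base step / [SemiAnbd] Prop. 3.2) — and the input `εF` of Thm. 2.4 (i)'s context isomorphism at `θ := φ`

Mochizuki, *The geometry of Frobenioids II*, Kyushu J. Math. **62** (2008) 401–460, §2, Theorem 2.4, p. 19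
[cite: MochizukiFrdII2008, Thm 2.4 (i) p.19]: "an equivalence of categories `Ψ : C₁ ⥲ C₂` — which … necessarily induces a
1-compatible equivalence of categories `Ψ_Base : D₁ ⥲ D₂`, hence an outer isomorphism of topological groups `Π₁ ⥲ Π₂`
[cf. [Mzk2], Proposition 3.2] …"; and proof of (ii), p. 21 [cite: MochizukiFrdII2008, Thm 2.4 (ii) p.21]: "`Ψ` induces a pair of
compatible isomorphisms `G₁ ⥲ G₂`; `K̄₁^× ⥲ K̄₂^×`".

PROOF-ONLY companion (cell abc-iut, node FrdII:Thm2.4(ii), junction «T24ii-J2» piece P3; seat abc-iut-L1-t7 gen 8).  The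
Frobenioid side of Thm. 2.4 (ii) (abc-iut-w5-d229: `PadicFrobenioidPairIsoLevelwise`, and `PadicFrobenioidPairIsoExposed`)
reads the isomorphism of topological groups `φ : Π₁ ⥲ Π₂` OFF A STRAIGHTENING `ι : (Π₁/N_k)_k ⋙ E ≅ (Π₂/N₂,k)_k` of the Galois
pro-system under `E = Ψ_Base : 𝓑^temp(Π₁)⁰ ⥲ 𝓑^temp(Π₂)⁰` (small models `CosetCat Πᵢ`): `r_{φ g} = ι⁻¹ ≫ E(r_g) ≫ ι`.  The
Kummer side (abc-iut-L1-t7: `PadicKummerThm24iFrobenioidRelBase.isoOfFunctorRelBasePush`) wants, for ITS `θ`, a natural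
isomorphism `εF : Ψ ⋙ Base₂ ⋙ incl ≅ Base₁ ⋙ incl ⋙ θ_*` over the RELATIVE small bases `RelCosetCat Πᵢ°` — which abc-iut-L1-t7
gen 6 constructed (`BaseGaloisSystem.pushIso`) from a straightening on the relative base.  This file joins the two at
`Π° = Π` (`RelCosetCat ⊤ ≅ CosetCat`, `PadicFrobenioidRelTop`), so that Thm. 2.4 (ii)'s `φ` and Thm. 2.4 (i)'s `θ` are THE
SAME homomorphism:
* §0 `ker_iff_of_map_ker_eq` — "`φ` lies over `G₁ ⥲ G₂`" in the pointwise form `hkerθ` from `φ(Ker φ₁) = Ker φ₂`;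
* §1 `relTop_straighten` — the straightening clause on `CosetCat` (automorphisms `toAutCoset`) IS the straightening clause on
  `RelCosetCat ⊤` (automorphisms `toAutRelCosetMulEquiv ⊤`) for the whiskered `ι` and the transported equivalence
  `E♭ = (⊤-incl) ≫ E ≫ (toRelTop)`;
* §2 `exists_pushIso_abs` — **`φ_* ≅ E` NATURALLY on `𝓑^temp(Π₁)⁰`** (abc-iut-L1-t7 gen 6's `pushIso` at `H = ⊤`, read back):
  [SemiAnbd] Prop. 3.2 for equivalences of the connected small bases, with the representative `φ` of the outer isomorphism
  the one singled out by `ι`;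
* §3 `exists_relTopBaseIso`, `exists_basePushIso_relTop` — for an equivalence `Ψ : C₁ ⥲ C₂` of `p`-adic Frobenioids over
  `CosetCat Πᵢ` with 1-compatibility `η : Ψ ⋙ Base₂ ≅ Base₁ ⋙ E` ([FrdI] Thm. 3.4 (v), BY NAME): the relative-base
  1-compatibility `η♭` of `Ψ♭ := relTopEquivalence Ψ`, and THE input
  `εF : Ψ♭ ⋙ Base₂♭ ⋙ incl ≅ Base₁♭ ⋙ incl ⋙ φ_*` of `isoOfFunctorRelBasePush` at `θ := φ`, with its component formula.
Theorems only (no definitions); classical Galois-category bookkeeping over landed files; nothing here bears on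
[IUTchIII] Cor. 3.12.
-/

noncomputable section

namespace Literature.AlgebraicGeometry.Frobenioids

open CategoryTheory Opposite Topology Filter
open Literature.AnabelianGeometry.SemiGraphs

universe u

namespace BaseGaloisSystem

/-! ### §0 "`φ` lies over `G₁ ⥲ G₂`", pointwise -/

/-- `φ(Ker(Π₁ → G_{ℚ_{p₁}})) = Ker(Π₂ → G_{ℚ_{p₂}})` in the pointwise form "`φ₁ x = 1 ↔ φ₂ (φ x) = 1`" (the `hkerθ` of
abc-iut-L1-t7's `isoGOfTheta`). [cite: MochizukiFrdII2008, Thm 2.4 (i) p.19] -/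
theorem ker_iff_of_map_ker_eq {G G₂ Q₁ Q₂ : Type*} [Group G] [Group G₂] [Group Q₁] [Group Q₂]
    (φ₁ : G →* Q₁) (φ₂ : G₂ →* Q₂) (φ : G ≃* G₂) (hker : φ₁.ker.map φ.toMonoidHom = φ₂.ker) (x : G) :
    φ₁ x = 1 ↔ φ₂ (φ x) = 1 := by
  rw [← MonoidHom.mem_ker, ← MonoidHom.mem_ker, ← hker]
  constructor
  · exact fun hx => Subgroup.mem_map_of_mem _ hx
  · rintro ⟨y, hy, hyx⟩
    rwa [← φ.injective (show φ y = φ x from hyx)]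

/-! ### §1 The straightening clause, from `CosetCat Π` to `RelCosetCat ⊤` -/

section Straighten

variable {G : Type u} [Group G] [TopologicalSpace G] (hG : IsTempered G)
  {G₂ : Type u} [Group G₂] [TopologicalSpace G₂] (hG₂ : IsTempered G₂)
  (E : CosetCat G ≌ CosetCat G₂)
  (N : ℕ → OpenNormalSubgroup G) (hN : Antitone N) (hNb : ∀ U ∈ 𝓝 (1 : G), ∃ k, (N k : Set G) ⊆ U)
  (N₂ : ℕ → OpenNormalSubgroup G₂) (hN₂ : Antitone N₂) (hN₂b : ∀ U ∈ 𝓝 (1 : G₂), ∃ k, (N₂ k : Set G₂) ⊆ U)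
  (ι : cosetSystem N hN ⋙ E.functor.op ≅ cosetSystem N₂ hN₂) (φ : G ≃* G₂)
  (hφ : ∀ g : G, toAutCoset N₂ hN₂ (φ g) =
    ι.conjAut ((Equivalence.congrRight (E := ℕ) E.op).functor.mapIso (toAutCoset N hN g)))

include hφ in
/-- The straightening clause at level `k`, as morphisms of `𝓑^temp(Π₂)⁰`: `r_{φ g} = ι_k ≫ E(r_g) ≫ ι_k⁻¹` on `Π₂/N₂,k`.
[cite: MochizukiFrdII2008, Thm 2.4 (ii) p.21] -/
theorem crightMul_eq_of_straighten (g : G) (k : ℕ) :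
    crightMul (N₂ k) (φ g) = (ι.hom.app k).unop ≫ E.functor.map (crightMul (N k) g) ≫ (ι.inv.app k).unop := by
  have hk := congrArg (fun γ : Aut (cosetSystem N₂ hN₂) => γ.hom.app k) (hφ g)
  simp only [toAutCoset_hom_app, Iso.conjAut_hom, Iso.conj_apply, NatTrans.comp_app, Functor.mapIso_hom] at hk
  have hmid : ((Equivalence.congrRight (E := ℕ) E.op).functor.map (toAutCoset N hN g).hom).app k =
      (E.functor.map (crightMul (N k) g)).op := rfl
  rw [hmid] at hk
  apply Quiver.Hom.op_inj
  exact hk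

include hφ in
/-- **The straightening clause on the relative base `𝓑^temp(Π, Π)⁰`.**  Under `RelCosetCat ⊤ ≅ CosetCat`
(`CosetCat.relTopEquiv`), the straightening `ι` whiskered along `toRelTop` reads off THE SAME `φ` through the automorphisms
`toAutRelCosetMulEquiv ⊤` of the relative Galois pro-systems, for the transported equivalence `incl ≫ E ≫ toRelTop` — the
hypothesis `hφ` of abc-iut-L1-t7 gen 6's `BaseGaloisSystem.pushIso` at `H = ⊤`. [cite: MochizukiFrdII2008, Thm 2.4 (ii) p.21] -/
theorem relTop_straighten (g : G) :
    toAutRelCosetMulEquiv (⊤ : OpenSubgroup G₂) N₂ hN₂ (fun _ => le_top) hG₂ hN₂b (φ g) =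
      (Functor.isoWhiskerRight ι CosetCat.toRelTop.op :
        relCosetSystem (⊤ : OpenSubgroup G) N hN (fun _ => le_top) ⋙
            (CosetCat.relTopEquiv.symm.trans (E.trans CosetCat.relTopEquiv)).functor.op ≅
          relCosetSystem (⊤ : OpenSubgroup G₂) N₂ hN₂ (fun _ => le_top)).conjAut
        ((Equivalence.congrRight (E := ℕ) (CosetCat.relTopEquiv.symm.trans (E.trans CosetCat.relTopEquiv)).op).functor.mapIso
          (toAutRelCosetMulEquiv (⊤ : OpenSubgroup G) N hN (fun _ => le_top) hG hNb g)) := by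
  apply Iso.ext
  ext k
  apply Quiver.Hom.unop_inj
  apply ObjectProperty.hom_ext _
  rw [toAutRelCosetMulEquiv_hom_app, crightMul_eq_of_straighten E N hN N₂ hN₂ ι φ hφ g k, Iso.conjAut_hom, Iso.conj_apply,
    NatTrans.comp_app, NatTrans.comp_app]
  -- the right-hand side is, definitionally, `ι_k ≫ E((r_g on the relative system)_k) ≫ ι_k⁻¹` read in `𝓑^temp(Π₂)⁰`
  change _ = (ι.hom.app k).unop ≫
    E.functor.map (((toAutRelCosetMulEquiv (⊤ : OpenSubgroup G) N hN (fun _ => le_top) hG hNb g).hom.app k).unop).hom ≫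
      (ι.inv.app k).unop
  rw [toAutRelCosetMulEquiv_hom_app]
  rfl

end Straighten

/-! ### §2 `φ_* ≅ E` naturally on `𝓑^temp(Π₁)⁰` -/

section PushAbs

variable {G : Type u} [Group G] [TopologicalSpace G] [IsTopologicalGroup G] (hG : IsTempered G)
  {G₂ : Type u} [Group G₂] [TopologicalSpace G₂] [IsTopologicalGroup G₂] (hG₂ : IsTempered G₂)
  (E : CosetCat G ≌ CosetCat G₂)
  (N : ℕ → OpenNormalSubgroup G) (hN : Antitone N) (hNb : ∀ U ∈ 𝓝 (1 : G), ∃ k, (N k : Set G) ⊆ U)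
  (N₂ : ℕ → OpenNormalSubgroup G₂) (hN₂ : Antitone N₂) (hN₂b : ∀ U ∈ 𝓝 (1 : G₂), ∃ k, (N₂ k : Set G₂) ⊆ U)
  (ι : cosetSystem N hN ⋙ E.functor.op ≅ cosetSystem N₂ hN₂) (φ : G ≃* G₂)
  (hφ : ∀ g : G, toAutCoset N₂ hN₂ (φ g) =
    ι.conjAut ((Equivalence.congrRight (E := ℕ) E.op).functor.mapIso (toAutCoset N hN g)))

include hG hG₂ hNb hN₂b hφ in
/-- **[FrdII] Thm. 2.4, base step / [SemiAnbd] Prop. 3.2 on the absolute small base, WITH THE REPRESENTATIVE NAMED.**  For an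
equivalence `E : 𝓑^temp(Π₁)⁰ ⥲ 𝓑^temp(Π₂)⁰` (`Πᵢ` tempered) and the isomorphism `φ : Π₁ ⥲ Π₂` read off a straightening `ι`
of the Galois pro-system under `E` (`r_{φ g} = ι⁻¹ ≫ E(r_g) ≫ ι`): `φ` is open and **`φ_* ≅ E` NATURALLY** — `E` "is"
push-forward along THIS representative of the outer isomorphism `Π₁ ⥲ Π₂` (abc-iut-L1-t7 gen 6's `BaseGaloisSystem.pushIso`
at `Π° = Π`, read back along `RelCosetCat ⊤ ≅ CosetCat`). [cite: MochizukiFrdII2008, Thm 2.4 (i) p.19] -/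
theorem exists_pushIso_abs :
    ∃ hφo : IsOpenMap φ.toMonoidHom, Nonempty (CosetCat.push φ.toMonoidHom hφo ≅ E.functor) := by
  have hφ' := relTop_straighten hG hG₂ E N hN hNb N₂ hN₂ hN₂b ι φ hφ
  have hφo := isOpenMap_mulEquiv hG ⊤ hG₂ ⊤ (CosetCat.relTopEquiv.symm.trans (E.trans CosetCat.relTopEquiv)) N hN
    (fun _ => le_top) hNb N₂ hN₂ (fun _ => le_top) hN₂b (Functor.isoWhiskerRight ι CosetCat.toRelTop.op) φ hφ'
  exact ⟨hφo, ⟨Functor.isoWhiskerLeft CosetCat.toRelTop (pushIso hG ⊤ hG₂ ⊤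
    (CosetCat.relTopEquiv.symm.trans (E.trans CosetCat.relTopEquiv)) N hN (fun _ => le_top) hNb N₂ hN₂ (fun _ => le_top)
    hN₂b (Functor.isoWhiskerRight ι CosetCat.toRelTop.op) φ hφ' hφo)⟩⟩

end PushAbs

end BaseGaloisSystem

/-! ### §3 The input `εF` of Thm. 2.4 (i)'s context isomorphism, at `θ := φ`, for an equivalence of `p`-adic Frobenioids -/

namespace PadicFrd.Datum

open BaseGaloisSystem

variable {p₁ p₂ : ℕ} [Fact p₁.Prime] [Fact p₂.Prime]
  {G : Type} [Group G] [TopologicalSpace G] [IsTopologicalGroup G] (hG : IsTempered G)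
  {G₂ : Type} [Group G₂] [TopologicalSpace G₂] [IsTopologicalGroup G₂] (hG₂ : IsTempered G₂)
  {d₁ : Datum (CosetCat G) p₁} {d₂ : Datum (CosetCat G₂) p₂}
  (Ψ : d₁.frobenioid ≌ d₂.frobenioid) (E : CosetCat G ≌ CosetCat G₂)
  (η : Ψ.functor ⋙ ModelFrobenioid.baseFunctor d₂.Φ d₂.B d₂.divB ≅ ModelFrobenioid.baseFunctor d₁.Φ d₁.B d₁.divB ⋙ E.functor)

omit [IsTopologicalGroup G] [IsTopologicalGroup G₂] in
/-- **The 1-compatibility of `Ψ♭ := relTopEquivalence Ψ` with the transported base equivalence `incl ≫ E ≫ toRelTop`**, from the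
1-compatibility `η : Ψ ⋙ Base₂ ≅ Base₁ ⋙ Ψ_Base` ([FrdI] Thm. 3.4 (v), BY NAME): `η♭_X = η_{X♮}` on underlying objects of
`𝓑^temp(Π₂)⁰` (`X♮ = ofRelTopFrob X`). [cite: MochizukiFrdII2008, Thm 2.4 (i) p.19] -/
theorem exists_relTopBaseIso :
    ∃ ηrel : (relTopEquivalence Ψ).functor ⋙ ModelFrobenioid.baseFunctor d₂.relTop.Φ d₂.relTop.B d₂.relTop.divB ≅
        ModelFrobenioid.baseFunctor d₁.relTop.Φ d₁.relTop.B d₁.relTop.divB ⋙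
          (CosetCat.relTopEquiv.symm.trans (E.trans CosetCat.relTopEquiv)).functor,
      ∀ X : d₁.relTop.frobenioid, (ηrel.hom.app X).hom = η.hom.app (d₁.ofRelTopFrob.obj X) ∧
        (ηrel.inv.app X).hom = η.inv.app (d₁.ofRelTopFrob.obj X) := by
  refine ⟨NatIso.ofComponents (fun X => CosetCat.toRelTop.mapIso (η.app (d₁.ofRelTopFrob.obj X))) ?_, fun X => ⟨rfl, rfl⟩⟩
  intro X Y f
  apply ObjectProperty.hom_ext _
  exact η.hom.naturality (d₁.ofRelTopFrob.map f)

include hG hG₂ in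
/-- **The input `εF : Ψ♭ ⋙ Base₂♭ ⋙ incl ≅ Base₁♭ ⋙ incl ⋙ φ_*` of abc-iut-L1-t7's `isoOfFunctorRelBasePush`, AT `θ := φ` THE
ISOMORPHISM READ OFF THE STRAIGHTENING `ι`.**  For an equivalence `Ψ : C₁ ⥲ C₂` of `p`-adic Frobenioids over `𝓑^temp(Πᵢ)⁰`
(`Πᵢ` tempered), a base equivalence `E` with 1-compatibility `η` ("`Ψ` … necessarily induces a 1-compatible equivalence …
`Ψ_Base`", [FrdI] Thm. 3.4 (v), BY NAME), a cofinal antitone `N` and a straightening `(N₂, ι, φ)` of the Galois pro-system under `E`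
(`r_{φ g} = ι⁻¹ ≫ E(r_g) ≫ ι`): `φ` is open and there is `εF` with components
`εF_X = η_{X♮} ≫ (pushIso_{X_D})⁻¹` — `η` followed by abc-iut-L1-t7 gen 6's natural `φ_* ≅ E♭` at `H = ⊤`.  Hence every
construction of `PadicKummerThm24iFrobenioidRelBase` / `…RelTheta` (`baseIsoOfPush`, `compat_ofPush`, `isoGOfTheta`,
`isoOfFunctorRelBasePush`) is available for THIS `φ` — the one over which Thm. 2.4 (ii)'s `ψ̄` is `φ`-equivariant.
[cite: MochizukiFrdII2008, Thm 2.4 (i) p.19] -/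
theorem exists_basePushIso_relTop (N : ℕ → OpenNormalSubgroup G) (hN : Antitone N)
    (hNb : ∀ U ∈ 𝓝 (1 : G), ∃ k, (N k : Set G) ⊆ U)
    (N₂ : ℕ → OpenNormalSubgroup G₂) (hN₂ : Antitone N₂) (hN₂b : ∀ U ∈ 𝓝 (1 : G₂), ∃ k, (N₂ k : Set G₂) ⊆ U)
    (ι : cosetSystem N hN ⋙ E.functor.op ≅ cosetSystem N₂ hN₂) (φ : G ≃* G₂)
    (hφ : ∀ g : G, toAutCoset N₂ hN₂ (φ g) =
      ι.conjAut ((Equivalence.congrRight (E := ℕ) E.op).functor.mapIso (toAutCoset N hN g))) :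
    ∃ (hφo : IsOpenMap φ.toMonoidHom)
      (hφrel : ∀ g : G, toAutRelCosetMulEquiv (⊤ : OpenSubgroup G₂) N₂ hN₂ (fun _ => le_top) hG₂ hN₂b (φ g) =
        (Functor.isoWhiskerRight ι CosetCat.toRelTop.op :
          relCosetSystem (⊤ : OpenSubgroup G) N hN (fun _ => le_top) ⋙
              (CosetCat.relTopEquiv.symm.trans (E.trans CosetCat.relTopEquiv)).functor.op ≅
            relCosetSystem (⊤ : OpenSubgroup G₂) N₂ hN₂ (fun _ => le_top)).conjAut
          ((Equivalence.congrRight (E := ℕ) (CosetCat.relTopEquiv.symm.trans (E.trans CosetCat.relTopEquiv)).op).functor.mapIso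
            (toAutRelCosetMulEquiv (⊤ : OpenSubgroup G) N hN (fun _ => le_top) hG hNb g)))
      (εF : (relTopEquivalence Ψ).functor ⋙ ModelFrobenioid.baseFunctor d₂.relTop.Φ d₂.relTop.B d₂.relTop.divB ⋙
          RelCosetCat.incl ⊤ ≅
        (ModelFrobenioid.baseFunctor d₁.relTop.Φ d₁.relTop.B d₁.relTop.divB ⋙ RelCosetCat.incl ⊤) ⋙
          CosetCat.push φ.toMonoidHom hφo),
      ∀ X : d₁.relTop.frobenioid,
        εF.hom.app X = η.hom.app (d₁.ofRelTopFrob.obj X) ≫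
          (pushIso hG ⊤ hG₂ ⊤ (CosetCat.relTopEquiv.symm.trans (E.trans CosetCat.relTopEquiv)) N hN (fun _ => le_top) hNb
            N₂ hN₂ (fun _ => le_top) hN₂b (Functor.isoWhiskerRight ι CosetCat.toRelTop.op) φ hφrel hφo).inv.app X.base := by
  have hφ' := relTop_straighten hG hG₂ E N hN hNb N₂ hN₂ hN₂b ι φ hφ
  have hφo := isOpenMap_mulEquiv hG ⊤ hG₂ ⊤ (CosetCat.relTopEquiv.symm.trans (E.trans CosetCat.relTopEquiv)) N hN
    (fun _ => le_top) hNb N₂ hN₂ (fun _ => le_top) hN₂b (Functor.isoWhiskerRight ι CosetCat.toRelTop.op) φ hφ'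
  obtain ⟨ηrel, hη⟩ := exists_relTopBaseIso Ψ E η
  refine ⟨hφo, hφ', RelGal.basePushIso (relTopEquivalence Ψ).functor
    (CosetCat.relTopEquiv.symm.trans (E.trans CosetCat.relTopEquiv)).functor ηrel φ.toMonoidHom hφo
    (pushIso hG ⊤ hG₂ ⊤ (CosetCat.relTopEquiv.symm.trans (E.trans CosetCat.relTopEquiv)) N hN (fun _ => le_top) hNb N₂ hN₂
      (fun _ => le_top) hN₂b (Functor.isoWhiskerRight ι CosetCat.toRelTop.op) φ hφ' hφo), fun X => ?_⟩
  rw [RelGal.basePushIso_hom_app, (hη X).1]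
  rfl

end PadicFrd.Datum

end Literature.AlgebraicGeometry.Frobenioids

end
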